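import Summits.Ventures.YMGap.RobustBall.StarDoorZdW
import HarnessLib

/-!
# Venture YMGap, track ROBUST-BALL (Y2) — crux Y2-X2-WZd-M, step 1a: the weighted star door on `ℤ^d` against a
# BOUNDED local observable (no Lipschitz hypothesis on the second observable), pointwise weights

HONEST FRAMING. WHAT THIS IS: a venture file (cell `pub-ymgap`, track Y2 ROBUST-BALL, seat ds-2). The
covariance half of the weighted star door `StarDoorZdW.lean` (`abs_covariance_le_of_starWindowBoundZdW`:
LOCAL `f, g`, BOTH with link-Lipschitz vectors, decay in the set distance) is re-read in the form the
MASSIVE-state conversion needs: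
* `abs_covariance_le_of_window_weighted_osc` — the abstract weighted Dobrushin–Shlosman covariance estimate
  of `Literature/…/DobrushinShlosmanWeightedInfiniteVolumeStates.lean` (Föllmer's tilt trick on the
  two-functional engine `DobrushinShlosman.abs_sub_le_window_weighted_infinite`, arbitrary index set, window
  kernels of ARBITRARY range) with the second observable `g` merely BOUNDED, local and of oscillation `≤ S_g`
  (the tilt density `g − g(τ₀) + S_g ∈ [0, 2 S_g]` needs no Lipschitz vector):
  `|cov_ν(f, g)| ≤ 2 S_g R Σ_{x ∈ Δf} e^{−t ρ(x)} δ_f(x)`;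
* `exists_starProfileW_pt` — the two-set profile of `StarDoorZdW.lean` with the POINTWISE conclusion
  `ρ(x) ≥ dist(x, Δg) − 2` on `Δf` (sup-distance of base points, `linkSetDist`);
* `abs_covariance_le_of_starWindowBoundZdW_osc` — for a specification on the links of `ℤ^d` with `SU(N)`
  spins carrying the weighted star window bound `StarWindowBoundZdW γ t ρ reach` (`ρ < 1`), every Gibbs
  measure `μ`, every bounded measurable LOCAL `f` with link-Lipschitz vector `δ_f` and every bounded measurable
  local `g` of oscillation `≤ S_g`:
  `|cov_μ(f, g)| ≤ 2 S_g (2√N) e^{2t} Σ_{x ∈ Δf} e^{−t·dist(x, Δg)} δ_f(x)`;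
The quasilocal form (bounded measurable `f` with a GLOBAL summable Lipschitz vector) and the MASSIVE-state
conversion follow in `MassiveOnBallZdW.lean` (step 1b/2 of «every member of the tier-2 weighted `ℤ^d` ball has a
MASSIVE DLR state through the star door»). WHAT THIS IS NOT: no number; strong-coupling LATTICE bookkeeping; nothing
about the continuum or the Millennium problem.

## References
* H. Föllmer, LNM 1362 (1988) Ch. I Thm. (2.13), Cor. (2.14), (2.20)–(2.24); H. Künsch, CMP 84 (1982);
  H.-O. Georgii (2011) Remark 8.26; R. L. Dobrushin, S. B. Shlosman (1985) Thm. 1.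
* The tree: `DobrushinShlosmanWeightedInfiniteVolume(States).lean` (this seat, g10; the proof of
  `abs_covariance_le_of_window_weighted` is followed line by line), `RobustBall/StarDoorZdW.lean` (g10),
  `RobustBall/QuasilocalCovariance.lean` (ds-3: the same oscillation form on the one-site layer).
-/

noncomputable section

open MeasureTheory ProbabilityTheory Function Finset Real Filter
open scoped NNReal Topology
open Literature.Probability.LatticeModels
open Literature.Probability.LatticeModels.DobrushinMetric (IsLipBound integrable_of_abs_le'
  abs_sub_le_mul_sum_of_dependsOn)
open Literature.Probability.LatticeModels.DobrushinShlosman (abs_sub_le_window_weighted_infinite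
  mul_windowAvg_eq_of_dependsOn)
open Literature.MathematicalPhysics.QuantumLattice
open Literature.MathematicalPhysics.QuantumFieldTheory (suFrobDist suFrobDist_nonneg suFrobDist_le
  suFrobDist_self setDistEdges linkSetDist linkSetDist_nonneg linkSetDist_eq_zero_of_mem setDistEdges_le_linkSetDist
  setDistEdges_nonneg)
open Summit.Ventures.YMGap.DSWindowZd

namespace Summit.Ventures.YMGap.RobustBall

/-! ### The abstract weighted window covariance estimate against a BOUNDED local observable -/

section Abstract

variable {V S : Type*} [MeasurableSpace S]

/-- **Covariance decay under the weighted window condition, arbitrary range and index set, against a BOUNDED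
local observable** (Föllmer 1988 Ch. I Thm. (2.13) / Cor. (2.14); Künsch 1982; Georgii 2011 Remark 8.26 —
the tilt trick inside Dobrushin–Shlosman's window iteration). Setting of the Literature engine
`DobrushinShlosman.abs_sub_le_window_weighted_infinite` (global window contraction (H1), weighted received
sums (H2) `≤ γ₀ < 1`, windows of arbitrary range on any index set `V`). For every Gibbs measure `ν`, a bounded
measurable `f` reading the finite set `Δf` with site-Lipschitz vector `δ_f`, a bounded measurable `g` reading
the finite set `Δg` of OSCILLATION `≤ S_g` (`|g σ − g τ| ≤ S_g` for all `σ, τ`; no Lipschitz vector), every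
finite `Λ ⊇ Δf` and every profile `ρ` with `ρ ≤ 0` off `Λ`, `ρ ≤ 0` on the sites of `Λ` lying in no window
`win c ⊆ Λ` (`c ∈ Λ`) that avoids `Δg`, and `ρ x ≤ ρ y + d(c; y, x)` whenever such a window `win c ∋ x`
receives influence from `y`: `|cov_ν(f, g)| ≤ 2 S_g R Σ_{x ∈ Δf} e^{−t ρ(x)} δ_f x` — verbatim the proof of
`DobrushinShlosman.abs_covariance_le_of_window_weighted` with the tilt density `g − g(τ₀) + S_g ∈ [0, 2 S_g]`.
[folklore] -/
theorem abs_covariance_le_of_window_weighted_osc [DecidableEq V] {γ : Specification V S}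
    (hγ : IsSpecification γ)
    {r : S → S → ℝ} {R : ℝ} (hr0 : ∀ a b, 0 ≤ r a b) (hrR : ∀ a b, r a b ≤ R) (hR : 0 ≤ R)
    (hrr : ∀ a, r a a = 0)
    {win : V → Finset V} {K : V → V → V → ℝ} (hK0 : ∀ c y x, 0 ≤ K c y x)
    (hcontract : ∀ (c : V) (ω η : V → S) (f : (V → S) → ℝ) (δ : V → ℝ), Measurable f →
      (∃ B, ∀ σ, |f σ| ≤ B) → DependsOn f (win c : Set V) → (∀ x, 0 ≤ δ x) →
      (∀ (x : V) (σ τ : V → S), (∀ v, v ≠ x → σ v = τ v) → |f σ - f τ| ≤ δ x * r (σ x) (τ x)) →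
        |∫ σ, f σ ∂(γ (win c) ω) - ∫ σ, f σ ∂(γ (win c) η)| ≤
          ∑ x ∈ win c, δ x * ∑' y, K c y x * r (ω y) (η y))
    {t : ℝ} (ht : 0 ≤ t) {d : V → V → V → ℝ} (hd0 : ∀ c y x, 0 ≤ d c y x)
    (hKs : ∀ c x, Summable fun y => K c y x * Real.exp (t * d c y x))
    {γ₀ : ℝ} (hγ₀ : 0 ≤ γ₀) (hγ₁ : γ₀ < 1)
    (hsumW : ∀ c, ∀ x ∈ win c, ∑' y, K c y x * Real.exp (t * d c y x) ≤ γ₀)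
    {ν : Measure (V → S)} (hν : IsGibbsMeasure γ ν) {f g : (V → S) → ℝ} (hfm : Measurable f)
    (hgm : Measurable g) {Bf Bg : ℝ} (hBf : ∀ σ, |f σ| ≤ Bf) (hBg : ∀ σ, |g σ| ≤ Bg)
    {Δf Δg : Finset V} (hfdep : DependsOn f (Δf : Set V)) (hgdep : DependsOn g (Δg : Set V))
    {δf : V → ℝ} (hδf : IsLipBound r f δf) {Sg : ℝ} (hSg : ∀ σ τ, |g σ - g τ| ≤ Sg)
    (Λ : Finset V) (hΔf : Δf ⊆ Λ) (ρ : V → ℝ) (hρout : ∀ y, y ∉ Λ → ρ y ≤ 0)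
    (hρunc : ∀ x ∈ Λ, (∀ c ∈ Λ, win c ⊆ Λ → (∀ z ∈ win c, z ∉ Δg) → x ∉ win c) → ρ x ≤ 0)
    (hρ : ∀ c ∈ Λ, win c ⊆ Λ → (∀ z ∈ win c, z ∉ Δg) → ∀ x ∈ win c, ∀ y, K c y x ≠ 0 →
      ρ x ≤ ρ y + d c y x) :
    |cov[f, g; ν]| ≤ 2 * Sg * R * ∑ x ∈ Δf, Real.exp (-(t * ρ x)) * δf x := by
  classical
  -- adapted from the tree's `DobrushinShlosman.abs_covariance_le_of_window_weighted` (this seat, g10):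
  -- the only change is the tilt density, built from the oscillation bound `S_g` instead of `R Σ δ_g`
  haveI := hν.isProbabilityMeasure
  obtain ⟨τ₀, -⟩ := nonempty_of_measure_ne_zero (μ := ν) (s := Set.univ) (by simp)
  have hδf0 : ∀ x, 0 ≤ δf x := hδf.nonneg
  have hSg0 : 0 ≤ Sg := (abs_nonneg _).trans (hSg τ₀ τ₀)
  have hosc : ∀ σ, |g σ - g τ₀| ≤ Sg := fun σ => hSg σ τ₀
  set gt : (V → S) → ℝ := fun σ => g σ + (Sg - g τ₀) with hgt
  have hgt0 : ∀ σ, 0 ≤ gt σ := fun σ => by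
    have := (abs_le.1 (hosc σ)).1; simp only [hgt]; linarith
  have hgtB : ∀ σ, gt σ ≤ 2 * Sg := fun σ => by
    have := (abs_le.1 (hosc σ)).2; simp only [hgt]; linarith
  have hgtm : Measurable gt := hgm.add_const _
  have hgtdep : DependsOn gt {v | (id v) ∈ Δg} := fun σ τ h => by
    simp only [hgt]; rw [hgdep h]
  have hgi : Integrable g ν := integrable_of_abs_le' hgm hBg
  have hgtabs : ∀ σ, |gt σ| ≤ 2 * Sg := fun σ => by
    rw [abs_of_nonneg (hgt0 σ)]; exact hgtB σ
  have hgti : Integrable gt ν := integrable_of_abs_le' hgtm hgtabs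
  -- the right-hand side is nonnegative
  have hRHS : 0 ≤ 2 * Sg * R * ∑ x ∈ Δf, Real.exp (-(t * ρ x)) * δf x := by
    have := Finset.sum_nonneg fun x (_ : x ∈ Δf) => mul_nonneg (Real.exp_nonneg (-(t * ρ x))) (hδf0 x)
    positivity
  -- `cov(f, g) = cov(f, g̃) = ν(f g̃) - ν(f) ν(g̃)`
  have hcov : cov[f, g; ν] = ∫ σ, f σ * gt σ ∂ν - (∫ σ, f σ ∂ν) * ∫ σ, gt σ ∂ν := by
    have h1 : cov[f, g; ν] = cov[f, gt; ν] := by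
      rw [hgt, covariance_add_const_right hgi]
    rw [h1, covariance_eq_sub]
    · rfl
    · exact memLp_of_bounded (a := -Bf) (b := Bf)
        (ae_of_all _ fun σ => abs_le.1 (hBf σ)) hfm.aestronglyMeasurable 2
    · exact memLp_of_bounded (a := -(2 * Sg)) (b := 2 * Sg)
        (ae_of_all _ fun σ => abs_le.1 (hgtabs σ)) hgtm.aestronglyMeasurable 2
  by_cases hz : ∫ σ, gt σ ∂ν = 0
  · -- degenerate case: `g̃ = 0` a.e., so the covariance vanishes
    have hae : gt =ᵐ[ν] 0 := (integral_eq_zero_iff_of_nonneg (fun σ => hgt0 σ) hgti).1 hz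
    have hfg : ∫ σ, f σ * gt σ ∂ν = 0 := by
      rw [← integral_zero (α := V → S) (μ := ν) (G := ℝ)]
      refine integral_congr_ae ?_
      filter_upwards [hae] with σ hσ
      simp [hσ]
    rw [hcov, hfg, hz, mul_zero, sub_zero, abs_zero]
    exact hRHS
  have hpos : 0 < ∫ σ, gt σ ∂ν := lt_of_le_of_ne (integral_nonneg hgt0) (Ne.symm hz)
  -- the two states: `ν` (invariant under every window kernel, DLR) and its tilt by `g̃` (invariant under the
  -- windows avoiding `Δg`)
  set E₁ : ((V → S) → ℝ) → ℝ := fun F => ∫ σ, F σ ∂ν with hE₁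
  set E₂ : ((V → S) → ℝ) → ℝ := fun F => (∫ σ, gt σ * F σ ∂ν) / ∫ σ, gt σ ∂ν with hE₂
  have h₁le : ∀ ⦃F : (V → S) → ℝ⦄ ⦃M : ℝ⦄, Measurable F → (∃ B, ∀ σ, |F σ| ≤ B) →
      (∀ σ, F σ ≤ M) → E₁ F ≤ M := by
    rintro F M hFm ⟨B, hB⟩ hM
    calc ∫ σ, F σ ∂ν ≤ ∫ _σ, M ∂ν := integral_mono (integrable_of_abs_le' hFm hB) (integrable_const M) hM
      _ = M := by simp
  have h₁ge : ∀ ⦃F : (V → S) → ℝ⦄ ⦃M : ℝ⦄, Measurable F → (∃ B, ∀ σ, |F σ| ≤ B) →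
      (∀ σ, M ≤ F σ) → M ≤ E₁ F := by
    rintro F M hFm ⟨B, hB⟩ hM
    calc M = ∫ _σ, M ∂ν := by simp
      _ ≤ ∫ σ, F σ ∂ν := integral_mono (integrable_const M) (integrable_of_abs_le' hFm hB) hM
  have h₁T : ∀ c ∈ Λ, win c ⊆ Λ → (∀ z ∈ win c, z ∉ Δg) → ∀ ⦃F : (V → S) → ℝ⦄, Measurable F →
      (∃ B, ∀ σ, |F σ| ≤ B) → E₁ (fun σ => ∫ τ, F τ ∂(γ (win c) σ)) = E₁ F := by
    rintro c - - - F hFm ⟨B, hB⟩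
    exact hν.integral_integral_eq hγ (win c) (integrable_of_abs_le' hFm hB)
  have hgfi : ∀ {F : (V → S) → ℝ}, Measurable F → ∀ {B : ℝ}, (∀ σ, |F σ| ≤ B) →
      Integrable (fun σ => gt σ * F σ) ν := fun hFm B hB =>
    hgti.mul_bdd hFm.aestronglyMeasurable (ae_of_all _ fun σ => by rw [Real.norm_eq_abs]; exact hB σ)
  have h₂le : ∀ ⦃F : (V → S) → ℝ⦄ ⦃M : ℝ⦄, Measurable F → (∃ B, ∀ σ, |F σ| ≤ B) →
      (∀ σ, F σ ≤ M) → E₂ F ≤ M := by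
    rintro F M hFm ⟨B, hB⟩ hM
    change (∫ σ, gt σ * F σ ∂ν) / ∫ σ, gt σ ∂ν ≤ M
    rw [div_le_iff₀ hpos]
    calc ∫ σ, gt σ * F σ ∂ν ≤ ∫ σ, gt σ * M ∂ν :=
          integral_mono (hgfi hFm hB) (hgti.mul_const M) fun σ => mul_le_mul_of_nonneg_left (hM σ) (hgt0 σ)
      _ = M * ∫ σ, gt σ ∂ν := by rw [integral_mul_const, mul_comm]
  have h₂ge : ∀ ⦃F : (V → S) → ℝ⦄ ⦃M : ℝ⦄, Measurable F → (∃ B, ∀ σ, |F σ| ≤ B) →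
      (∀ σ, M ≤ F σ) → M ≤ E₂ F := by
    rintro F M hFm ⟨B, hB⟩ hM
    change M ≤ (∫ σ, gt σ * F σ ∂ν) / ∫ σ, gt σ ∂ν
    rw [le_div_iff₀ hpos]
    calc M * ∫ σ, gt σ ∂ν = ∫ σ, gt σ * M ∂ν := by rw [integral_mul_const, mul_comm]
      _ ≤ ∫ σ, gt σ * F σ ∂ν :=
          integral_mono (hgti.mul_const M) (hgfi hFm hB) fun σ => mul_le_mul_of_nonneg_left (hM σ) (hgt0 σ)
  have h₂T : ∀ c ∈ Λ, win c ⊆ Λ → (∀ z ∈ win c, z ∉ Δg) → ∀ ⦃F : (V → S) → ℝ⦄, Measurable F →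
      (∃ B, ∀ σ, |F σ| ≤ B) → E₂ (fun σ => ∫ τ, F τ ∂(γ (win c) σ)) = E₂ F := by
    rintro c - - hc F hFm ⟨B, hB⟩
    change (∫ η, gt η * (∫ σ, F σ ∂(γ (win c) η)) ∂ν) / ∫ σ, gt σ ∂ν = (∫ σ, gt σ * F σ ∂ν) / ∫ σ, gt σ ∂ν
    congr 1
    simp_rw [mul_windowAvg_eq_of_dependsOn hγ (cell := id) (W := win c) (fun v => Iff.rfl) hgtdep hc]
    exact hν.integral_integral_eq hγ (win c) (hgfi hFm hB)
  -- the two-functional comparison for `f`, with its Lipschitz vector cut down to `Δf`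
  have hfdepΛ : DependsOn f (Λ : Set V) :=
    hfdep.mono fun v hv => Finset.mem_coe.2 (hΔf (Finset.mem_coe.1 hv))
  have key := abs_sub_le_window_weighted_infinite hγ hr0 hrR hR hrr hK0 hcontract ht hd0 hKs hγ₀ hγ₁ hsumW Λ
    (fun c => ∀ z ∈ win c, z ∉ Δg) h₁le h₁ge h₁T h₂le h₂ge h₂T ρ hρout hρunc hρ hfm hBf hfdepΛ
    (hδf.restrict hfdep)
  have hsumΔ : ∑ x ∈ Λ, Real.exp (-(t * ρ x)) * (if x ∈ Δf then δf x else 0) =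
      ∑ x ∈ Δf, Real.exp (-(t * ρ x)) * δf x := by
    have h1 : ∑ x ∈ Λ, Real.exp (-(t * ρ x)) * (if x ∈ Δf then δf x else 0) =
        ∑ x ∈ Λ, (if x ∈ Δf then Real.exp (-(t * ρ x)) * δf x else 0) :=
      Finset.sum_congr rfl fun x _ => by split_ifs <;> simp
    rw [h1, Finset.sum_ite_mem, Finset.inter_eq_right.2 hΔf]
  rw [hsumΔ] at key
  change |∫ σ, f σ ∂ν - (∫ σ, gt σ * f σ ∂ν) / ∫ σ, gt σ ∂ν| ≤
    R * ∑ x ∈ Δf, Real.exp (-(t * ρ x)) * δf x at key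
  -- `cov = ν(g̃) · (ν_{g̃}(f) - ν(f))`
  have hfgt : ∫ σ, f σ * gt σ ∂ν = ∫ σ, gt σ * f σ ∂ν :=
    integral_congr_ae (ae_of_all _ fun σ => mul_comm _ _)
  have hident : cov[f, g; ν] =
      (∫ σ, gt σ ∂ν) * ((∫ σ, gt σ * f σ ∂ν) / ∫ σ, gt σ ∂ν - ∫ σ, f σ ∂ν) := by
    rw [hcov, hfgt, mul_sub, mul_div_cancel₀ _ hz]
    ring
  rw [hident, abs_mul, abs_of_pos hpos, abs_sub_comm]
  have hgtint : ∫ σ, gt σ ∂ν ≤ 2 * Sg := by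
    calc ∫ σ, gt σ ∂ν ≤ ∫ _σ, 2 * Sg ∂ν := integral_mono hgti (integrable_const _) hgtB
      _ = 2 * Sg := by simp
  have hkey0 : 0 ≤ R * ∑ x ∈ Δf, Real.exp (-(t * ρ x)) * δf x :=
    mul_nonneg hR (Finset.sum_nonneg fun x _ => mul_nonneg (Real.exp_nonneg _) (hδf0 x))
  calc (∫ σ, gt σ ∂ν) * |∫ σ, f σ ∂ν - (∫ σ, gt σ * f σ ∂ν) / ∫ σ, gt σ ∂ν|
      ≤ (2 * Sg) * (R * ∑ x ∈ Δf, Real.exp (-(t * ρ x)) * δf x) :=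
        mul_le_mul hgtint key (abs_nonneg _) (by positivity)
    _ = 2 * Sg * R * ∑ x ∈ Δf, Real.exp (-(t * ρ x)) * δf x := by ring

end Abstract

/-! ### The pointwise two-set profile on `ℤ^d` -/

variable {d N : ℕ}

/-- **The two-set profile for covariance decay, weighted form, POINTWISE conclusion.** For finite `Δf, Δg`
there are a finite `Λ ⊇ Δf` and the real profile `ρ x = min(dist(x, Δg) − 2, M − 1 − ‖x.1‖_∞)` with: `ρ ≤ 0` off
`Λ`; `ρ ≤ 0` on the links of `Λ` lying in no star `⊆ Λ` (centred in `Λ`) that avoids `Δg`;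
`ρ x ≤ ρ y + reach(c.1, y)` along every star; and `ρ(x) ≥ dist(x, Δg) − 2` for EVERY `x ∈ Δf` (`dist` =
`linkSetDist`, sup-distance of base points) — the twin of `exists_starProfileW` (whose last clause is the set
distance). [folklore] -/
theorem exists_starProfileW_pt (reach : Site d → ZdEdge d → ℝ)
    (hreach : ∀ (s : Site d), ∀ x ∈ vertexStarZd s, ∀ y : ZdEdge d, ‖x.1 - y.1‖ ≤ reach s y)
    (K : Site d → ZdEdge d → ZdEdge d → ℝ) (Δf Δg : Finset (ZdEdge d)) :
    ∃ (Λ : Finset (ZdEdge d)) (ρ : ZdEdge d → ℝ), Δf ⊆ Λ ∧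
      (∀ y, y ∉ Λ → ρ y ≤ 0) ∧
      (∀ x ∈ Λ, (∀ c ∈ Λ, starWinZd c ⊆ Λ → (∀ z ∈ starWinZd c, z ∉ Δg) → x ∉ starWinZd c) → ρ x ≤ 0) ∧
      (∀ c ∈ Λ, starWinZd c ⊆ Λ → (∀ z ∈ starWinZd c, z ∉ Δg) → ∀ x ∈ starWinZd c, ∀ y,
        K c.1 y x ≠ 0 → ρ x ≤ ρ y + reach c.1 y) ∧
      (∀ x ∈ Δf, linkSetDist Δg x - 2 ≤ ρ x) := by
  classical
  -- adapted from `exists_starProfileW` (this seat, g10): the box radius absorbs the largest distance on `Δf`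
  set B : ℕ := Δf.sup fun x => supNormZd x.1 with hB
  set Df : ℕ := Δf.sup fun x => ⌈linkSetDist Δg x⌉₊ with hDf
  set M : ℕ := B + Df + 2 with hM
  refine ⟨(box d M) ×ˢ (Finset.univ : Finset (Fin d)),
    fun x => min (linkSetDist Δg x - 2) ((M : ℝ) - 1 - supNormZd x.1), ?_, ?_, ?_, ?_, ?_⟩
  · intro x hx
    have hxB : supNormZd x.1 ≤ B := Finset.le_sup (f := fun x : ZdEdge d => supNormZd x.1) hx
    exact vertexStarZd_subset_box (s := x.1) (by omega) (self_mem_vertexStarZd x)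
  · intro y hy
    have h := lt_supNormZd_of_not_mem_box hy
    have h' : (M : ℝ) + 1 ≤ supNormZd y.1 := by exact_mod_cast h
    exact (min_le_right _ _).trans (by linarith)
  · intro x hx hunc
    by_cases hdeep : supNormZd x.1 + 2 ≤ M
    · -- the own star of `x` lies inside `Λ`, hence meets `Δg`: `dist(x, Δg) ≤ 2`
      have hsub := vertexStarZd_subset_box (s := x.1) (M := M) (by omega)
      have hmeet : ∃ z ∈ starWinZd x, z ∈ Δg := by
        by_contra hcon
        exact hunc x hx hsub (fun z hz hzg => hcon ⟨z, hz, hzg⟩) (self_mem_starWinZd x)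
      obtain ⟨z, hz, hzg⟩ := hmeet
      have h1 : linkSetDist Δg x ≤ linkSetDist Δg z + ‖x.1 - z.1‖ := linkSetDist_le_add_norm Δg x z
      rw [linkSetDist_eq_zero_of_mem hzg, zero_add] at h1
      have h2 := norm_sub_le_two_of_mem_vertexStarZd (self_mem_vertexStarZd x) hz
      exact (min_le_left _ _).trans (by linarith)
    · have h' : (M : ℝ) ≤ supNormZd x.1 + 1 := by exact_mod_cast Nat.lt_succ_iff.1 (by omega)
      exact (min_le_right _ _).trans (by linarith)
  · intro c _ _ _ x hx y _
    have h1 := supNormZd_le_supNormZd_add_norm y.1 x.1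
    have h2 : ‖y.1 - x.1‖ ≤ reach c.1 y := by rw [norm_sub_rev]; exact hreach c.1 x hx y
    have h3 : linkSetDist Δg x ≤ linkSetDist Δg y + ‖x.1 - y.1‖ := linkSetDist_le_add_norm Δg x y
    have h4 : ‖x.1 - y.1‖ ≤ reach c.1 y := hreach c.1 x hx y
    calc min (linkSetDist Δg x - 2) ((M : ℝ) - 1 - supNormZd x.1)
        ≤ min (linkSetDist Δg y - 2 + reach c.1 y) ((M : ℝ) - 1 - supNormZd y.1 + reach c.1 y) :=
          min_le_min (by linarith) (by linarith)
      _ = min (linkSetDist Δg y - 2) ((M : ℝ) - 1 - supNormZd y.1) + reach c.1 y := min_add_add_right _ _ _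
  · intro x hx
    have hxB : supNormZd x.1 ≤ B := Finset.le_sup (f := fun x : ZdEdge d => supNormZd x.1) hx
    have hxD : ⌈linkSetDist Δg x⌉₊ ≤ Df := Finset.le_sup (f := fun x : ZdEdge d => ⌈linkSetDist Δg x⌉₊) hx
    have h' : (supNormZd x.1 : ℝ) ≤ B := by exact_mod_cast hxB
    have hD' : (⌈linkSetDist Δg x⌉₊ : ℝ) ≤ Df := by exact_mod_cast hxD
    have hM' : (M : ℝ) = B + Df + 2 := by rw [hM]; push_cast; ring
    have hceil := Nat.le_ceil (linkSetDist Δg x)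
    refine le_min le_rfl ?_
    rw [hM']; linarith

/-! ### The weighted star door against a bounded local observable: local and quasilocal `f` -/

/-- **EXPONENTIAL CLUSTERING OF EVERY GIBBS MEASURE through the weighted star door, against a BOUNDED local
observable, pointwise weights.** For a specification `γ` on the links of `ℤ^d` with `SU(N)` spins carrying the
weighted star window bound (`ρ < 1`, `t ≥ 0`, reach dominating the sup-distance from the star), every Gibbs
measure `μ`, every bounded measurable `f` depending on the finite `Δf` with link-Lipschitz vector `δ_f`
(Frobenius weight), and every bounded measurable `g` depending on the finite `Δg` with oscillation `≤ S_g`: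
`|cov_μ(f, g)| ≤ 2 S_g (2√N) e^{2t} Σ_{x ∈ Δf} e^{−t·dist(x, Δg)} δ_f(x)`. [folklore] -/
theorem abs_covariance_le_of_starWindowBoundZdW_osc {γ : Specification (ZdEdge d) (SUN N)}
    (hγ : IsSpecification γ) {t ρ : ℝ} (ht : 0 ≤ t) (hρ0 : 0 ≤ ρ) (hρ1 : ρ < 1)
    {reach : Site d → ZdEdge d → ℝ} (hreach0 : ∀ s y, 0 ≤ reach s y)
    (hreach : ∀ (s : Site d), ∀ x ∈ vertexStarZd s, ∀ y : ZdEdge d, ‖x.1 - y.1‖ ≤ reach s y)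
    (h : StarWindowBoundZdW d N γ t ρ reach suFrobDist)
    {μ : Measure (LGConfig d (SUN N))} (hμ : IsGibbsMeasure γ μ)
    {f g : LGConfig d (SUN N) → ℝ} (hfm : Measurable f) (hgm : Measurable g) {Bf Bg : ℝ}
    (hBf : ∀ σ, |f σ| ≤ Bf) (hBg : ∀ σ, |g σ| ≤ Bg) {Δf Δg : Finset (ZdEdge d)}
    (hfdep : DependsOn f (Δf : Set (ZdEdge d))) (hgdep : DependsOn g (Δg : Set (ZdEdge d)))
    {δf : ZdEdge d → ℝ} (hδf : IsLipBound suFrobDist f δf) {Sg : ℝ} (hSg : ∀ σ τ, |g σ - g τ| ≤ Sg) :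
    |cov[f, g; μ]| ≤ 2 * Sg * (2 * Real.sqrt N) * Real.exp (2 * t) *
      ∑ x ∈ Δf, Real.exp (-(t * linkSetDist Δg x)) * δf x := by
  classical
  obtain ⟨K, hK0, hKs, hcontract, hsum⟩ := h
  have hR₀ : (0 : ℝ) ≤ 2 * Real.sqrt N := by positivity
  obtain ⟨Λ, ρf, hΔΛ, hout, hunc, hlip, hm⟩ := exists_starProfileW_pt reach hreach K Δf Δg
  have key := abs_covariance_le_of_window_weighted_osc hγ suFrobDist_nonneg suFrobDist_le
    hR₀ suFrobDist_self (win := starWinZd) (K := fun c => K c.1) (fun c y x => hK0 _ _ _) hcontract ht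
    (d := fun c y _ => reach c.1 y) (fun c y _ => hreach0 _ _) (fun c x => hKs c.1 x) hρ0 hρ1
    (fun c x hx => hsum c.1 x hx) hμ hfm hgm hBf hBg hfdep hgdep hδf hSg Λ hΔΛ ρf hout hunc hlip
  refine key.trans ?_
  have hSg0 : 0 ≤ Sg := (abs_nonneg _).trans (hSg (fun _ => 1) (fun _ => 1))
  have hsum : ∑ x ∈ Δf, Real.exp (-(t * ρf x)) * δf x ≤
      ∑ x ∈ Δf, Real.exp (2 * t) * (Real.exp (-(t * linkSetDist Δg x)) * δf x) := by
    refine Finset.sum_le_sum fun x hx => ?_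
    rw [← mul_assoc, ← Real.exp_add]
    refine mul_le_mul_of_nonneg_right (Real.exp_le_exp.2 ?_) (hδf.nonneg x)
    nlinarith [hm x hx, ht]
  calc 2 * Sg * (2 * Real.sqrt N) * ∑ x ∈ Δf, Real.exp (-(t * ρf x)) * δf x
      ≤ 2 * Sg * (2 * Real.sqrt N) * ∑ x ∈ Δf, Real.exp (2 * t) * (Real.exp (-(t * linkSetDist Δg x)) * δf x) :=
        mul_le_mul_of_nonneg_left hsum (by positivity)
    _ = 2 * Sg * (2 * Real.sqrt N) * Real.exp (2 * t) * ∑ x ∈ Δf, Real.exp (-(t * linkSetDist Δg x)) * δf x := by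
        rw [← Finset.mul_sum]; ring

end Summit.Ventures.YMGap.RobustBall

end
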